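import Literature.Analysis.FluidPDE.FluidComputer.ThresholdTransfer
import Literature.Analysis.FluidPDE.FluidComputer.DrainConversionTime
import Literature.Analysis.FluidPDE.FluidComputer.DrainConversionSharp
import HarnessLib

/-!
# Fluid computer blueprint — the threshold gate: the drain-conversion rungs on a forced window

HONEST FRAMING: low prior, high value-of-information experiment on Tao's machine paradigm; NOT a
claim that NS blows up. Elementary estimates for the 5-mode circuit `thresholdCircuit`
(`ThresholdGate.lean`) on a forced window (`IsForcedWindow`, `ThresholdTransfer.lean`); nothing is
asserted about any fluid equation and the transfer stage itself remains OPEN.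

The `(carrier, conduit)` block of `thresholdCircuit` is `a' = -(rc)·d + p`, `d' = (rc)·a - (κã)·d + q`
with `p = -εab - σac + μc² + g_a`, `q = g_d`; so the time-form drain-conversion rungs of
`DrainConversionTime.lean` (`DampedRotor.energy_decay_time`, `DampedRotor.output_buildup_time`)
apply verbatim with `ω = r·c`, `g = κ·ã`, forcing level `P = εR² + σRCm + μCm² + δ`, and the rotor
angle `Θ` (`Θ(0) = 0`, right derivative `r·c`, as in `ThresholdTransferAngle.lean`):

* `energy_abs_sub_le`, `pairEnergy_floor` — energy drift `≤ 10Rδ·t` and the bookkeeping floor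
  `a² + d² ≥ E(0) - 10Rδt - b² - c² - ã²` (the `u₀` of the build-up phase);
* `pair_energy_decay` — in a damping band `γ₀·rc ≤ κã ≤ γ₁·rc`:
  `a(t)² + d(t)² ≤ exp(-λΘ(t))·(3(a(0)² + d(0)²) + 12R·P·exp(λΘM)·t)`, `λ = γ₀/(3(1 + γ₁²))`;
* `pair_energy_decay_sharp` — the same with the SHARP rate of `DrainConversionSharp.lean`: for
  `γ₀ < 2` and any `0 ≤ λ ≤ λ* = γ₀ - γ₀²(γ₁ - γ₀)/(8(1 - γ₀/2))`,
  `(1 - γ₀/2)(a(t)² + d(t)²) ≤ exp(-λΘ(t))·((1 + γ₀/2)(a(0)² + d(0)²) + 8R·P·exp(λΘM)·t)`;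
* `output_buildup` — under weak damping `0 ≤ κã ≤ γ₁·rc`, `γ₁ ≤ 2`, pair energy `≥ u₀`:
  `ã(t) ≥ ã(0) - K₀R² + (K₀/2)(1 - γ₁/2)u₀·Θ(t) - (K₀R·P + δ)·t`, `K₀ = κ/(rCm)`.

What remains of the drain conversion for the successor: the pair-energy floor `u₀` during build-up
(energy bookkeeping), the gluing angle at which `κã/(rc)` reaches `γ₀` and the band ceiling `γ₁`
until completion (the window must end before the clock reversal collapses `c`), and the carrier
sign on the window. [cite: Tao2016AveragedNS, §5.5 Thm 5.3 (5.5) (third window: energy transfer)]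
-/

noncomputable section

open Set Filter Topology
open scoped NNReal

namespace Literature.Analysis.FluidPDE.FluidComputer

open Literature.Analysis.FluidPDE.Tao2016AveragedNS Literature.Analysis.ODE

variable {ε σ ν μ r κ δ τ : ℝ} {x : ℝ → Fin 5 → ℝ} {Θ : ℝ → ℝ}

namespace IsForcedWindow

/-- **Energy drift on a forced window**: `|E(t) - E(0)| ≤ 10Rδ·t` (five modes; the general
`abs_energy_sub_le_of_isCancelling` of `ThresholdGate.lean`). [cite: Tao2016AveragedNS, §5 (g-cancel)] -/
theorem energy_abs_sub_le (h : IsForcedWindow ε σ ν μ r κ δ τ x) {R : ℝ} (hR0 : 0 ≤ R)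
    (hRall : ∀ t ∈ Ico 0 τ, ∀ i, |x t i| ≤ R) :
    ∀ t ∈ Icc 0 τ, |energy (x t) - energy (x 0)| ≤ 10 * (δ * R) * t := by
  intro t ht
  have hn : ∀ s ∈ Ico 0 τ, ‖x s‖ ≤ R := fun s hs =>
    (pi_norm_le_iff_of_nonneg hR0).2 fun i => by rw [Real.norm_eq_abs]; exact hRall s hs i
  have h5 := abs_energy_sub_le_of_isCancelling (isCancelling_thresholdCircuit ε σ ν μ r κ)
    h.continuousOn h.defect hn t ht
  norm_num at h5
  linarith

/-- **Pair-energy floor by bookkeeping**: `a(t)² + d(t)² ≥ E(0) - 10Rδ·t - b(t)² - c(t)² - ã(t)²`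
— the input `u₀` of `output_buildup` during the build-up phase, once the clock, trigger and output
levels are bounded there. [folklore] -/
theorem pairEnergy_floor (h : IsForcedWindow ε σ ν μ r κ δ τ x) {R : ℝ} (hR0 : 0 ≤ R)
    (hRall : ∀ t ∈ Ico 0 τ, ∀ i, |x t i| ≤ R) :
    ∀ t ∈ Icc 0 τ, energy (x 0) - 10 * (δ * R) * t - x t 1 ^ 2 - x t 2 ^ 2 - x t 4 ^ 2 ≤
      x t 0 ^ 2 + x t 3 ^ 2 := by
  intro t ht
  have hd := (abs_le.1 (h.energy_abs_sub_le hR0 hRall t ht)).1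
  have he : energy (x t) = x t 0 ^ 2 + x t 1 ^ 2 + x t 2 ^ 2 + x t 3 ^ 2 + x t 4 ^ 2 := by
    rw [energy, Fin.sum_univ_five]
  linarith

/-- **Pair-energy decay on a forced window** (instantiation of `DampedRotor.energy_decay_time`):
while the angle-damping is in a band, `γ₀·rc ≤ κã ≤ γ₁·rc` (`0 < γ₀ ≤ γ₁`), `0 ≤ c ≤ Cm`,
`|xᵢ| ≤ R` and `Θ ≤ ΘM` on the window, the unconverted pair energy decays in ANGLE:
`a(t)² + d(t)² ≤ exp(-λΘ(t))·(3(a(0)² + d(0)²) + 12R·P·exp(λΘM)·t)`, `λ = γ₀/(3(1 + γ₁²))`,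
`P = εR² + σRCm + μCm² + δ`. [folklore] -/
theorem pair_energy_decay (h : IsForcedWindow ε σ ν μ r κ δ τ x) (hε : 0 ≤ ε) (hσ : 0 ≤ σ)
    (hμ : 0 ≤ μ) (hr : 0 ≤ r) (hδ : 0 ≤ δ) {R Cm γ₀ γ₁ ΘM : ℝ} (hR : 0 ≤ R) (hCm : 0 ≤ Cm)
    (hγ₀ : 0 < γ₀) (hγ₁ : γ₀ ≤ γ₁) (hΘ0 : Θ 0 = 0) (hΘc : ContinuousOn Θ (Icc 0 τ))
    (hΘ' : ∀ t ∈ Ico 0 τ, HasDerivWithinAt Θ (r * x t 2) (Ici t) t)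
    (hΘM : ∀ t ∈ Icc 0 τ, Θ t ≤ ΘM) (hc : ∀ t ∈ Ico 0 τ, 0 ≤ x t 2 ∧ x t 2 ≤ Cm)
    (hRall : ∀ t ∈ Ico 0 τ, ∀ i, |x t i| ≤ R)
    (hband : ∀ t ∈ Ico 0 τ, γ₀ * (r * x t 2) ≤ κ * x t 4 ∧ κ * x t 4 ≤ γ₁ * (r * x t 2)) :
    ∀ t ∈ Icc 0 τ, x t 0 ^ 2 + x t 3 ^ 2 ≤
      Real.exp (-(γ₀ / (3 * (1 + γ₁ ^ 2))) * Θ t) * (3 * (x 0 0 ^ 2 + x 0 3 ^ 2) +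
        12 * R * (ε * R ^ 2 + σ * R * Cm + μ * Cm ^ 2 + δ) *
          Real.exp (γ₀ / (3 * (1 + γ₁ ^ 2)) * ΘM) * t) := by
  choose! V hV hVδ using h.defect
  have hP : 0 ≤ ε * R ^ 2 + σ * R * Cm + μ * Cm ^ 2 + δ := by positivity
  refine DampedRotor.energy_decay_time (a := fun t => x t 0) (d := fun t => x t 3)
    (a' := fun t => V t 0) (d' := fun t => V t 3) (ω := fun t => r * x t 2)
    (g := fun t => κ * x t 4) (Θ := Θ)
    ((continuous_apply 0).comp_continuousOn h.continuousOn)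
    ((continuous_apply 3).comp_continuousOn h.continuousOn)
    (fun s hs => (hasDerivWithinAt_pi.1 (hV s hs)) 0)
    (fun s hs => (hasDerivWithinAt_pi.1 (hV s hs)) 3) hΘc hΘ0 hΘ' hΘM
    (fun s hs => mul_nonneg hr (hc s hs).1) hγ₀ hγ₁ hband hR hP
    (fun s hs => ⟨hRall s hs 0, hRall s hs 3⟩) (fun s hs => ?_) (fun s hs => ?_)
  · -- `|a' + ωd| = |-εab - σac + μc² + g_a| ≤ P`
    have hg := abs_apply_le_of_norm_le (hVδ s hs) 0
    rw [Pi.sub_apply, thresholdCircuit_apply_zero] at hg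
    obtain ⟨hc0, hcC⟩ := hc s hs
    have ha := abs_le.1 (hRall s hs 0)
    have hb := abs_le.1 (hRall s hs 1)
    have hab : |x s 0 * x s 1| ≤ R * R := by
      rw [abs_mul]; exact mul_le_mul (hRall s hs 0) (hRall s hs 1) (abs_nonneg _) hR
    have hac : |x s 0 * x s 2| ≤ R * Cm := by
      rw [abs_mul, abs_of_nonneg hc0]
      exact mul_le_mul (hRall s hs 0) hcC hc0 hR
    have hcc : x s 2 ^ 2 ≤ Cm ^ 2 := pow_le_pow_left₀ hc0 hcC 2
    have e : V s 0 + r * x s 2 * x s 3 =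
        (V s 0 - (-(ε * x s 0 * x s 1) - σ * x s 0 * x s 2 + μ * x s 2 ^ 2 - r * x s 3 * x s 2)) +
        (-(ε * (x s 0 * x s 1)) - σ * (x s 0 * x s 2) + μ * x s 2 ^ 2) := by ring
    rw [e]
    have h1 := abs_le.1 hab; have h2 := abs_le.1 hac
    refine (abs_add_le _ _).trans ?_
    have h3 : |-(ε * (x s 0 * x s 1)) - σ * (x s 0 * x s 2) + μ * x s 2 ^ 2| ≤
        ε * R ^ 2 + σ * R * Cm + μ * Cm ^ 2 := by
      rw [abs_le]; constructor <;> nlinarith [h1.1, h1.2, h2.1, h2.2, hcc, sq_nonneg (x s 2),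
        mul_nonneg hμ (sq_nonneg (x s 2))]
    linarith [hg, h3]
  · -- `|d' - (ωa - gd)| = |g_d| ≤ δ ≤ P`
    have hg := abs_apply_le_of_norm_le (hVδ s hs) 3
    rw [Pi.sub_apply, thresholdCircuit_apply_three] at hg
    have e : V s 3 - (r * x s 2 * x s 0 - κ * x s 4 * x s 3) =
        V s 3 - (r * x s 0 * x s 2 - κ * x s 3 * x s 4) := by ring
    rw [e]
    have : 0 ≤ ε * R ^ 2 + σ * R * Cm + μ * Cm ^ 2 := by positivity
    linarith [hg]

/-- **Sharp pair-energy decay on a forced window** (instantiation of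
`DampedRotor.energy_decay_time_sharp`): as `pair_energy_decay`, with `γ₀ < 2` and any rate
`0 ≤ λ ≤ γ₀ - γ₀²(γ₁ - γ₀)/(8(1 - γ₀/2))`. [folklore] -/
theorem pair_energy_decay_sharp (h : IsForcedWindow ε σ ν μ r κ δ τ x) (hε : 0 ≤ ε) (hσ : 0 ≤ σ)
    (hμ : 0 ≤ μ) (hr : 0 ≤ r) (hδ : 0 ≤ δ) {R Cm γ₀ γ₁ lam ΘM : ℝ} (hR : 0 ≤ R) (hCm : 0 ≤ Cm)
    (hγ₀ : 0 < γ₀) (hγ₂ : γ₀ < 2) (hγ₁ : γ₀ ≤ γ₁) (hlam0 : 0 ≤ lam)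
    (hlam : lam ≤ γ₀ - γ₀ ^ 2 * (γ₁ - γ₀) / (8 * (1 - γ₀ / 2)))
    (hΘ0 : Θ 0 = 0) (hΘc : ContinuousOn Θ (Icc 0 τ))
    (hΘ' : ∀ t ∈ Ico 0 τ, HasDerivWithinAt Θ (r * x t 2) (Ici t) t)
    (hΘM : ∀ t ∈ Icc 0 τ, Θ t ≤ ΘM) (hc : ∀ t ∈ Ico 0 τ, 0 ≤ x t 2 ∧ x t 2 ≤ Cm)
    (hRall : ∀ t ∈ Ico 0 τ, ∀ i, |x t i| ≤ R)
    (hband : ∀ t ∈ Ico 0 τ, γ₀ * (r * x t 2) ≤ κ * x t 4 ∧ κ * x t 4 ≤ γ₁ * (r * x t 2)) :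
    ∀ t ∈ Icc 0 τ, (1 - γ₀ / 2) * (x t 0 ^ 2 + x t 3 ^ 2) ≤
      Real.exp (-lam * Θ t) * ((1 + γ₀ / 2) * (x 0 0 ^ 2 + x 0 3 ^ 2) +
        8 * R * (ε * R ^ 2 + σ * R * Cm + μ * Cm ^ 2 + δ) * Real.exp (lam * ΘM) * t) := by
  choose! V hV hVδ using h.defect
  have hP : 0 ≤ ε * R ^ 2 + σ * R * Cm + μ * Cm ^ 2 + δ := by positivity
  refine DampedRotor.energy_decay_time_sharp (a := fun t => x t 0) (d := fun t => x t 3)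
    (a' := fun t => V t 0) (d' := fun t => V t 3) (ω := fun t => r * x t 2)
    (g := fun t => κ * x t 4) (Θ := Θ)
    ((continuous_apply 0).comp_continuousOn h.continuousOn)
    ((continuous_apply 3).comp_continuousOn h.continuousOn)
    (fun s hs => (hasDerivWithinAt_pi.1 (hV s hs)) 0)
    (fun s hs => (hasDerivWithinAt_pi.1 (hV s hs)) 3) hΘc hΘ0 hΘ' hΘM
    (fun s hs => mul_nonneg hr (hc s hs).1) hγ₀ hγ₂ hγ₁ hlam0 hlam hband hR hP
    (fun s hs => ⟨hRall s hs 0, hRall s hs 3⟩) (fun s hs => ?_) (fun s hs => ?_)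
  · have hg := abs_apply_le_of_norm_le (hVδ s hs) 0
    rw [Pi.sub_apply, thresholdCircuit_apply_zero] at hg
    obtain ⟨hc0, hcC⟩ := hc s hs
    have hab : |x s 0 * x s 1| ≤ R * R := by
      rw [abs_mul]; exact mul_le_mul (hRall s hs 0) (hRall s hs 1) (abs_nonneg _) hR
    have hac : |x s 0 * x s 2| ≤ R * Cm := by
      rw [abs_mul, abs_of_nonneg hc0]
      exact mul_le_mul (hRall s hs 0) hcC hc0 hR
    have hcc : x s 2 ^ 2 ≤ Cm ^ 2 := pow_le_pow_left₀ hc0 hcC 2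
    have e : V s 0 + r * x s 2 * x s 3 =
        (V s 0 - (-(ε * x s 0 * x s 1) - σ * x s 0 * x s 2 + μ * x s 2 ^ 2 - r * x s 3 * x s 2)) +
        (-(ε * (x s 0 * x s 1)) - σ * (x s 0 * x s 2) + μ * x s 2 ^ 2) := by ring
    rw [e]
    have h1 := abs_le.1 hab; have h2 := abs_le.1 hac
    refine (abs_add_le _ _).trans ?_
    have h3 : |-(ε * (x s 0 * x s 1)) - σ * (x s 0 * x s 2) + μ * x s 2 ^ 2| ≤
        ε * R ^ 2 + σ * R * Cm + μ * Cm ^ 2 := by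
      rw [abs_le]; constructor <;> nlinarith [h1.1, h1.2, h2.1, h2.2, hcc, sq_nonneg (x s 2),
        mul_nonneg hμ (sq_nonneg (x s 2))]
    linarith [hg, h3]
  · have hg := abs_apply_le_of_norm_le (hVδ s hs) 3
    rw [Pi.sub_apply, thresholdCircuit_apply_three] at hg
    have e : V s 3 - (r * x s 2 * x s 0 - κ * x s 4 * x s 3) =
        V s 3 - (r * x s 0 * x s 2 - κ * x s 3 * x s 4) := by ring
    rw [e]
    have : 0 ≤ ε * R ^ 2 + σ * R * Cm + μ * Cm ^ 2 := by positivity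
    linarith [hg]

/-- **Output build-up on a forced window** (instantiation of `DampedRotor.output_buildup_time` with
`Φ = ã + δt`, `K₀ = κ/(rCm)`): while the damping is still weak, `0 ≤ κã ≤ γ₁·rc` with `γ₁ ≤ 2`,
`0 ≤ c ≤ Cm` (`Cm > 0`), `|xᵢ| ≤ R` on the closed window and the pair energy `a² + d² ≥ u₀`:
`ã(t) ≥ ã(0) - K₀R² + (K₀/2)(1 - γ₁/2)u₀·Θ(t) - (K₀R·P + δ)·t`. [folklore] -/
theorem output_buildup (h : IsForcedWindow ε σ ν μ r κ δ τ x) (hε : 0 ≤ ε) (hσ : 0 ≤ σ)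
    (hμ : 0 ≤ μ) (hr : 0 < r) (hκ : 0 ≤ κ) (hδ : 0 ≤ δ) {R Cm γ₁ u₀ : ℝ} (hR : 0 ≤ R)
    (hCm : 0 < Cm) (hγ₁ : γ₁ ≤ 2) (hΘ0 : Θ 0 = 0) (hΘc : ContinuousOn Θ (Icc 0 τ))
    (hΘ' : ∀ t ∈ Ico 0 τ, HasDerivWithinAt Θ (r * x t 2) (Ici t) t)
    (hc : ∀ t ∈ Ico 0 τ, 0 ≤ x t 2 ∧ x t 2 ≤ Cm) (hRall : ∀ t ∈ Icc 0 τ, ∀ i, |x t i| ≤ R)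
    (hu : ∀ t ∈ Ico 0 τ, u₀ ≤ x t 0 ^ 2 + x t 3 ^ 2)
    (hband : ∀ t ∈ Ico 0 τ, 0 ≤ κ * x t 4 ∧ κ * x t 4 ≤ γ₁ * (r * x t 2)) :
    ∀ t ∈ Icc 0 τ,
      x 0 4 - κ / (r * Cm) * R ^ 2 + κ / (r * Cm) / 2 * ((1 - γ₁ / 2) * u₀) * Θ t -
        (κ / (r * Cm) * R * (ε * R ^ 2 + σ * R * Cm + μ * Cm ^ 2 + δ) + δ) * t ≤ x t 4 := by
  choose! V hV hVδ using h.defect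
  have hP : 0 ≤ ε * R ^ 2 + σ * R * Cm + μ * Cm ^ 2 + δ := by positivity
  have hK₀ : 0 ≤ κ / (r * Cm) := by positivity
  intro t ht
  have hmain := DampedRotor.output_buildup_time (a := fun t => x t 0) (d := fun t => x t 3)
    (a' := fun t => V t 0) (d' := fun t => V t 3) (ω := fun t => r * x t 2)
    (g := fun t => κ * x t 4) (Θ := Θ) (Φ := fun t => x t 4 + δ * t)
    (Φ' := fun t => V t 4 + δ * 1) (K₀ := κ / (r * Cm)) (u₀ := u₀) (T := τ)
    ((continuous_apply 0).comp_continuousOn h.continuousOn)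
    ((continuous_apply 3).comp_continuousOn h.continuousOn)
    (((continuous_apply 4).comp_continuousOn h.continuousOn).add
      (continuousOn_const.mul continuousOn_id))
    (fun s hs => (hasDerivWithinAt_pi.1 (hV s hs)) 0)
    (fun s hs => (hasDerivWithinAt_pi.1 (hV s hs)) 3)
    (fun s hs => ((hasDerivWithinAt_pi.1 (hV s hs)) 4).add
      ((hasDerivWithinAt_id s _).const_mul δ))
    hΘc hΘ0 hΘ' (fun s hs => mul_nonneg hr.le (hc s hs).1) hK₀ (fun s hs => ?_) hband hγ₁ hR hP
    (fun s hs => ⟨hRall s hs 0, hRall s hs 3⟩) hu (fun s hs => ?_) (fun s hs => ?_) t ht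
  · linarith
  · -- `Φ' = κd² + g_ã + δ ≥ κd² ≥ (κ/(rCm))·(rc)·d²`
    have hg := abs_apply_le_of_norm_le (hVδ s hs) 4
    rw [Pi.sub_apply, thresholdCircuit_apply_four] at hg
    have h1 := (abs_le.1 hg).1
    obtain ⟨hc0, hcC⟩ := hc s hs
    have h2 : κ / (r * Cm) * (r * x s 2) * x s 3 ^ 2 ≤ κ * x s 3 ^ 2 := by
      have e : κ / (r * Cm) * (r * x s 2) = κ * (x s 2 / Cm) := by field_simp
      rw [e]
      have h3 : x s 2 / Cm ≤ 1 := by rw [div_le_one hCm]; exact hcC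
      have h4 : 0 ≤ κ * x s 3 ^ 2 := by positivity
      have h5 : 0 ≤ x s 2 / Cm := by positivity
      nlinarith
    show κ / (r * Cm) * (r * x s 2) * x s 3 ^ 2 ≤ V s 4 + δ * 1
    linarith
  · -- forcing of the carrier, as in `pair_energy_decay`
    have hs' : s ∈ Icc 0 τ := Ico_subset_Icc_self hs
    have hg := abs_apply_le_of_norm_le (hVδ s hs) 0
    rw [Pi.sub_apply, thresholdCircuit_apply_zero] at hg
    obtain ⟨hc0, hcC⟩ := hc s hs
    have hab : |x s 0 * x s 1| ≤ R * R := by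
      rw [abs_mul]; exact mul_le_mul (hRall s hs' 0) (hRall s hs' 1) (abs_nonneg _) hR
    have hac : |x s 0 * x s 2| ≤ R * Cm := by
      rw [abs_mul, abs_of_nonneg hc0]
      exact mul_le_mul (hRall s hs' 0) hcC hc0 hR
    have hcc : x s 2 ^ 2 ≤ Cm ^ 2 := pow_le_pow_left₀ hc0 hcC 2
    have e : V s 0 + r * x s 2 * x s 3 =
        (V s 0 - (-(ε * x s 0 * x s 1) - σ * x s 0 * x s 2 + μ * x s 2 ^ 2 - r * x s 3 * x s 2)) +
        (-(ε * (x s 0 * x s 1)) - σ * (x s 0 * x s 2) + μ * x s 2 ^ 2) := by ring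
    show |V s 0 + r * x s 2 * x s 3| ≤ _
    rw [e]
    have h1 := abs_le.1 hab; have h2 := abs_le.1 hac
    refine (abs_add_le _ _).trans ?_
    have h3 : |-(ε * (x s 0 * x s 1)) - σ * (x s 0 * x s 2) + μ * x s 2 ^ 2| ≤
        ε * R ^ 2 + σ * R * Cm + μ * Cm ^ 2 := by
      rw [abs_le]; constructor <;> nlinarith [h1.1, h1.2, h2.1, h2.2, hcc, sq_nonneg (x s 2),
        mul_nonneg hμ (sq_nonneg (x s 2))]
    linarith [hg, h3]
  · have hg := abs_apply_le_of_norm_le (hVδ s hs) 3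
    rw [Pi.sub_apply, thresholdCircuit_apply_three] at hg
    have e : V s 3 - (r * x s 2 * x s 0 - κ * x s 4 * x s 3) =
        V s 3 - (r * x s 0 * x s 2 - κ * x s 3 * x s 4) := by ring
    show |V s 3 - (r * x s 2 * x s 0 - κ * x s 4 * x s 3)| ≤ _
    rw [e]
    have : 0 ≤ ε * R ^ 2 + σ * R * Cm + μ * Cm ^ 2 := by positivity
    linarith [hg]

end IsForcedWindow

end Literature.Analysis.FluidPDE.FluidComputer

end
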